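import Summits.CriticalPhenomena.PercolationContinuityZ3.Theorems.Transplant.PlanarSkeletonFrmQuasiDefs
import Summits.CriticalPhenomena.PercolationContinuityZ3.Theorems.Transplant.SkelPhiCorridorKGValues
import Summits.CriticalPhenomena.PercolationContinuityZ3.Theorems.Transplant.SkelFrmQuasiBChoiceNums
import Summits.CriticalPhenomena.PercolationContinuityZ3.Theorems.Transplant.SkelFrmBChoiceNums
import Summits.CriticalPhenomena.PercolationContinuityZ3.Theorems.Transplant.SkelFrmQuasiBParamsLF
import Summits.CriticalPhenomena.PercolationContinuityZ3.Theorems.Transplant.SkelFrmBParamsLF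
import Summits.CriticalPhenomena.PercolationContinuityZ3.Theorems.Transplant.SkelFrmQuasi1ParamsLBL
import Summits.CriticalPhenomena.PercolationContinuityZ3.Theorems.Transplant.SkelFrm1ParamsLBL
import Summits.CriticalPhenomena.PercolationContinuityZ3.Theorems.Transplant.SkelFrmFromBParamsCorrKG
import Summits.CriticalPhenomena.PercolationContinuityZ3.Theorems.Transplant.SkelFrmQuasi1ParamsPO
import HarnessLib
import Summits.CriticalPhenomena.PercolationContinuityZ3.Theorems.Transplant.SkelFrmBParamsCorrKG
/-!
# GEN-Q PORT (WAVE-Q table v0.8 section 2, row G023, U-level L5; captain R-6/R-7 2026-08-27: carrier token swap `PlanarSkeletonFrmFrom ↦ PlanarSkeletonFrmQuasi`)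
# of the tree module «Transplant/SkelFrmFromBParamsCorrKG» (sha256 d2d9fc0b737730b2…) onto the quasi-step carrier `PlanarSkeletonFrmQuasi` (p507026): «SkelFrmQuasiBParamsCorrKG»

HAND HUNK (L-FLOORMAP-1 ①, reader of G017 «SkelFrmQuasiBChoiceNums»): the corridor kit's level displacement reads the cost-`N` kit of record — `kgR := KS0.R'0 ↦ KS0.R'0N κ Φ (KS.NQ Φ)`,
`gFloorKG := 8·KS0.R'0 + 3·Mu + 6 ↦ 8·KS0.R'0N κ Φ (KS.NQ Φ) + 3·Mu + 6` (the two `KS0.R'0` sites; nothing else in the kept cone reads the kit).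

ORIGINAL TITLE: N2 (frames-only node `SamePDropOfSkeletonFrmFrom₁`, OPEN) — (ζ″) ledger, THE K-G CORRIDOR SLOT VALUES INSTANTIATED, FIRST AXIS (E-corridor):

builds on p205010 (kernel theorem, internal audit signed; external expert review pending) — nothing in this file uses p205010; NOTHING is claimed about any open node
((N3-b), the end state).  Lane `prim-bschramm`, seat `prim-bschramm-stmt` (gen 33; GEN-Q column pen; tool = captain gen-1 g4's port_genq.py R-14 --cone + p3-g30's T1 patch).  Helper file (`--supports stmt-CriticalPhenomena-4575 --as helper`).
PORT RULES (U-wave r1–r4 re-used, GEN-Q hunk classes of p3-g29 #6136): declaration order, names and proof texts are those of «SkelFrmFromBParamsCorrKG», byte-identical except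
(i) the carrier token `PlanarSkeletonFrmFrom ↦ PlanarSkeletonFrmQuasi` in binders, `namespace`/`end` lines and qualified names (module names `SkelFrmFrom… ↦ SkelFrmQuasi…`
in imports of already-ported rows); (ii) `Φ.step ↦ Φ.qstep` with the called Steps lemma replaced by its `…Q`/`_q` twin and the cost `Φ.M` threaded (none in this file unless
listed below); (iii) `Φ.cyl_connected ↦ Φ.cyl_reach` readers (none unless listed); (iv) graph-ball radii / window floors ×`Φ.M` (none unless listed).  Carrier-free
residents stay imported/exported from the original «SkelFrmBParamsCorrKG» exactly as in the FrmFrom port.  Docstrings and citations are the original's.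

-/

open scoped Classical

noncomputable section

namespace Summit.CriticalPhenomena.PercolationContinuityZ3.Theorems.Transplant

namespace PlanarSkeletonFrmQuasi

namespace NegB

open Literature.Probability.Percolation Literature.Probability.LatticeModels SimpleGraph
open SkelConc (Consts)
open Skelφ (shearUnit kgSL kgP kgΔ kgN kgFar KGRows)
open Neg

/-! ## §1 The inputs of record -/

section Inputs

variable (κ : Consts) {V : Type} [DecidableEq V] [Countable V] {G : SimpleGraph V} [G.LocallyFinite] (Φ : PlanarSkeletonFrmQuasi G) (t : V) (p : unitInterval)
  (D : Skelφ.StepI.DataNS V) (g f mk qx Wx : ℕ)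

/-- **The corridor displacement slot** `R′ := R′0` (the (S0) kit block's level displacement). [this work] -/
def kgR (κ : Consts) {V : Type} [DecidableEq V] [Countable V] {G : SimpleGraph V} [G.LocallyFinite] (Φ : PlanarSkeletonFrmQuasi G) (t : V) (p : unitInterval) (D : Skelφ.StepI.DataNS V) (mk : ℕ) : ℕ := KS0.R'0N κ Φ (KS.NQ Φ) t p D mk

export PlanarSkeletonFrmFrom.NegB (kgρ)

/-- **The phase-2 window slot** `W := sL.toNat + Wx` (`Wx` = the residual for the start-box row `hbW`). [this work] -/
def kgW (κ : Consts) {V : Type} [DecidableEq V] [Countable V] {G : SimpleGraph V} [G.LocallyFinite] (Φ : PlanarSkeletonFrmQuasi G) (t : V) (p : unitInterval) (D : Skelφ.StepI.DataNS V) (g : ℕ) (f : ℕ) (Wx : ℕ) : ℕ := (kgSL (nL κ Φ t p D g f) (ℓL κ Φ t p D g f) (hL κ Φ t p D g f)).toNat + Wx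

/-- **The along start-extent slot** `q := 2·n_L + qx` (`qx` = the residual for the start-box row `haq`). [this work] -/
def kgq (κ : Consts) {V : Type} [DecidableEq V] [Countable V] {G : SimpleGraph V} [G.LocallyFinite] (Φ : PlanarSkeletonFrmQuasi G) (t : V) (p : unitInterval) (D : Skelφ.StepI.DataNS V) (g : ℕ) (f : ℕ) (qx : ℕ) : ℕ := 2 * nL κ Φ t p D g f + qx

/-- **The cell pitch along x′** in lattice units: `20·K·n_L`. [cite: KozmaNitzan2024, §4 p. 26 (29)] -/
def pitch (κ : Consts) {V : Type} [DecidableEq V] [Countable V] {G : SimpleGraph V} [G.LocallyFinite] (Φ : PlanarSkeletonFrmQuasi G) (t : V) (p : unitInterval) (D : Skelφ.StepI.DataNS V) (g : ℕ) (f : ℕ) : ℤ := 20 * (Neg.K κ : ℤ) * (nL κ Φ t p D g f : ℤ)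

/-- **The steering target** `tgt := pitch + (n + ρ − 1)/2 + (n + Δ)/2`. [this work] -/
def kgTgt (κ : Consts) {V : Type} [DecidableEq V] [Countable V] {G : SimpleGraph V} [G.LocallyFinite] (Φ : PlanarSkeletonFrmQuasi G) (t : V) (p : unitInterval) (D : Skelφ.StepI.DataNS V) (g : ℕ) (f : ℕ) (mk : ℕ) : ℤ :=
  pitch κ Φ t p D g f + ((nL κ Φ t p D g f : ℤ) + kgρ D - 1) / 2 +
    ((nL κ Φ t p D g f : ℤ) + kgΔ (vL κ Φ t p D g f) (kgR κ Φ t p D mk) (kgρ D)) / 2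

-- GEN-Q (R-2, captain 2026-08-27): `PlanarSkeletonFrmFrom.NegB.kgNv` is not in the used cone of the node top — not ported.

/-- **The corridor floor on the box slot**: `8·R′0 + 3·M_u + 6`. [this work] -/
def gFloorKG (κ : Consts) {V : Type} [DecidableEq V] [Countable V] {G : SimpleGraph V} [G.LocallyFinite] (Φ : PlanarSkeletonFrmQuasi G) (t : V) (p : unitInterval) (D : Skelφ.StepI.DataNS V) (mk : ℕ) : ℕ := 8 * KS0.R'0N κ Φ (KS.NQ Φ) t p D mk + 3 * Mu D + 6

-- GEN-Q (R-2, captain 2026-08-27): `PlanarSkeletonFrmFrom.NegB.kg_inputs_eq` is not in the used cone of the node top — not ported.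

end Inputs

/-! ## §2 The rows `KGRows` at the values -/

section Rows

variable (κ : Consts) {V : Type} [DecidableEq V] [Countable V] {G : SimpleGraph V} [G.LocallyFinite] (Φ : PlanarSkeletonFrmQuasi G) (t : V) (p : unitInterval)
  (D : Skelφ.StepI.DataNS V) (g f : ℕ)

/-- `(shearUnit n_L h_L : ℤ) = n_L + |h_L|`. [folklore] -/
theorem shearUnit_cast (κ : Consts) {V : Type} [DecidableEq V] [Countable V] {G : SimpleGraph V} [G.LocallyFinite] (Φ : PlanarSkeletonFrmQuasi G) (t : V) (p : unitInterval) (D : Skelφ.StepI.DataNS V) (g : ℕ) (f : ℕ) : ((shearUnit (nL κ Φ t p D g f) (hL κ Φ t p D g f) : ℕ) : ℤ) = (nL κ Φ t p D g f : ℤ) + |hL κ Φ t p D g f| := by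
  simp [Skelφ.shearUnit]

/-- **The layer inequality, spent once**: `M_L·(n_L + |h_L|) + |h_L| ≤ n_L·ℓ_L`. [folklore] -/
theorem ML_mul_U_le (κ : Consts) {V : Type} [DecidableEq V] [Countable V] {G : SimpleGraph V} [G.LocallyFinite] (Φ : PlanarSkeletonFrmQuasi G) (t : V) (p : unitInterval) (D : Skelφ.StepI.DataNS V) (g : ℕ) (f : ℕ) (hN : EqNumL κ Φ t p D g f) :
    (ML κ Φ t p D g : ℤ) * ((nL κ Φ t p D g f : ℤ) + |hL κ Φ t p D g f|) + |hL κ Φ t p D g f| ≤ (nL κ Φ t p D g f : ℤ) * ℓL κ Φ t p D g f := by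
  have h := hN.layer
  nlinarith [abs_nonneg (hL κ Φ t p D g f)]

/-- **`M_L − 1 ≤ sL`** (`sL = ⌊(nℓ − U + 1)/U⌋`, `U = n + |h|`). [folklore] -/
theorem ML_sub_one_le_kgSL (κ : Consts) {V : Type} [DecidableEq V] [Countable V] {G : SimpleGraph V} [G.LocallyFinite] (Φ : PlanarSkeletonFrmQuasi G) (t : V) (p : unitInterval) (D : Skelφ.StepI.DataNS V) (g : ℕ) (f : ℕ) (hN : EqNumL κ Φ t p D g f) :
    (ML κ Φ t p D g : ℤ) - 1 ≤ kgSL (nL κ Φ t p D g f) (ℓL κ Φ t p D g f) (hL κ Φ t p D g f) := by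
  have h := ML_mul_U_le κ Φ t p D g f hN
  have hn1 : (1 : ℤ) ≤ nL κ Φ t p D g f := by exact_mod_cast (one_le_of_eqNumL κ Φ t p D g f hN).1
  have ha : (0 : ℤ) ≤ |hL κ Φ t p D g f| := abs_nonneg _
  unfold Skelφ.kgSL
  rw [shearUnit_cast]
  apply Int.le_ediv_of_mul_le (by linarith)
  nlinarith

/-- `(n_L + |h_L| : ℕ) ≤ n_L·ℓ_L + 1` (`hlay`). [folklore] -/
theorem hlay_at (κ : Consts) {V : Type} [DecidableEq V] [Countable V] {G : SimpleGraph V} [G.LocallyFinite] (Φ : PlanarSkeletonFrmQuasi G) (t : V) (p : unitInterval) (D : Skelφ.StepI.DataNS V) (g : ℕ) (f : ℕ) (hN : EqNumL κ Φ t p D g f) :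
    ((nL κ Φ t p D g f + (hL κ Φ t p D g f).natAbs : ℕ) : ℤ) ≤ (nL κ Φ t p D g f : ℤ) * ℓL κ Φ t p D g f + 1 := by
  have h := ML_mul_U_le κ Φ t p D g f hN
  have h960 := slack_floor_le_ML κ Φ t p D g
  have hM : (959 : ℤ) ≤ ML κ Φ t p D g := by
    have : 959 ≤ ML κ Φ t p D g := by omega
    exact_mod_cast this
  have ha : (0 : ℤ) ≤ |hL κ Φ t p D g f| := abs_nonneg _
  have hn : (0 : ℤ) ≤ nL κ Φ t p D g f := by positivity
  push_cast
  nlinarith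

/-- `M_u·U ≤ n_L·ℓ_L` in `ℕ` (for `hρP`, `hρL`). [folklore] -/
theorem Mu_mul_U_le (κ : Consts) {V : Type} [DecidableEq V] [Countable V] {G : SimpleGraph V} [G.LocallyFinite] (Φ : PlanarSkeletonFrmQuasi G) (t : V) (p : unitInterval) (D : Skelφ.StepI.DataNS V) (g : ℕ) (f : ℕ) (hN : EqNumL κ Φ t p D g f) :
    Mu D * shearUnit (nL κ Φ t p D g f) (hL κ Φ t p D g f) ≤ nL κ Φ t p D g f * ℓL κ Φ t p D g f := by
  have h := ML_mul_U_le κ Φ t p D g f hN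
  have hMu : ((Mu D : ℕ) : ℤ) ≤ ML κ Φ t p D g := by exact_mod_cast Mu_le_ML κ Φ t p D g
  have ha : (0 : ℤ) ≤ |hL κ Φ t p D g f| := abs_nonneg _
  have hn : (0 : ℤ) ≤ nL κ Φ t p D g f := by positivity
  have hZ : ((Mu D : ℕ) : ℤ) * ((nL κ Φ t p D g f : ℤ) + |hL κ Φ t p D g f|) ≤ (nL κ Φ t p D g f : ℤ) * ℓL κ Φ t p D g f := by nlinarith
  have hU := shearUnit_cast κ Φ t p D g f
  have : ((Mu D * shearUnit (nL κ Φ t p D g f) (hL κ Φ t p D g f) : ℕ) : ℤ) ≤ ((nL κ Φ t p D g f * ℓL κ Φ t p D g f : ℕ) : ℤ) := by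
    push_cast [hU]
    exact hZ
  exact_mod_cast this

-- GEN-Q (R-2, captain 2026-08-27): `PlanarSkeletonFrmFrom.NegB.kgRows_of` is not in the used cone of the node top — not ported.

end Rows

/-! ## §3 The run length's bound -/

section RunLength

variable (κ : Consts) {V : Type} [DecidableEq V] [Countable V] {G : SimpleGraph V} [G.LocallyFinite] (Φ : PlanarSkeletonFrmQuasi G) (t : V) (p : unitInterval)
  (D : Skelφ.StepI.DataNS V) (g f mk qx Wx : ℕ)

-- GEN-Q (R-2, captain 2026-08-27): `PlanarSkeletonFrmFrom.NegB.kgNv_le_div` is not in the used cone of the node top — not ported.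

/-- `0 ≤ pitch` and `0 ≤ tgt`. [folklore] -/
theorem kgTgt_nonneg (κ : Consts) {V : Type} [DecidableEq V] [Countable V] {G : SimpleGraph V} [G.LocallyFinite] (Φ : PlanarSkeletonFrmQuasi G) (t : V) (p : unitInterval) (D : Skelφ.StepI.DataNS V) (g : ℕ) (f : ℕ) (mk : ℕ) : 0 ≤ pitch κ Φ t p D g f ∧ 0 ≤ kgTgt κ Φ t p D g f mk := by
  have hp : 0 ≤ pitch κ Φ t p D g f := by unfold pitch; positivity
  refine ⟨hp, ?_⟩
  unfold kgTgt Skelφ.kgΔ kgρ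
  have ha : (0 : ℤ) ≤ |vL κ Φ t p D g f| := abs_nonneg _
  have h1 : (0 : ℤ) ≤ ((nL κ Φ t p D g f : ℤ) + ((Mu D + 1 : ℕ) : ℤ) - 1) / 2 := Int.ediv_nonneg (by push_cast; omega) (by norm_num)
  have h2 : (0 : ℤ) ≤ ((nL κ Φ t p D g f : ℤ) + (8 * ((kgR κ Φ t p D mk : ℕ) : ℤ) + 7 * ((Mu D + 1 : ℕ) : ℤ) + |vL κ Φ t p D g f|)) / 2 :=
    Int.ediv_nonneg (by positivity) (by norm_num)
  linarith

-- GEN-Q (R-2, captain 2026-08-27): `PlanarSkeletonFrmFrom.NegB.kgNv_le` is not in the used cone of the node top — not ported.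

end RunLength

end NegB

end PlanarSkeletonFrmQuasi

end Summit.CriticalPhenomena.PercolationContinuityZ3.Theorems.Transplant

end
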